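import Mathlib
import Literature.AlgebraicGeometry.Resolution.FormalInverseFunction
import Literature.AlgebraicGeometry.Resolution.WeightedShear
import Summits.ResolutionOfSingularities.ResolutionOfSingularities.Theorems.WeightedInvariantLocalWeightedDropWildMonicFlagAssembly
import Summits.ResolutionOfSingularities.ResolutionOfSingularities.Theorems.WeightedInvariantLocalWeightedDropWildMonicFlagAttainShape
import Summits.ResolutionOfSingularities.ResolutionOfSingularities.Theorems.WeightedInvariantLocalWeightedDropWildMonicFlagTripleDefs
import Summits.ResolutionOfSingularities.ResolutionOfSingularities.Theorems.WeightedInvariantLocalWeightedDropWildMonicFlagTripleBasic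
import Summits.ResolutionOfSingularities.ResolutionOfSingularities.Theorems.WeightedInvariantLocalWeightedDropWildMonicWCleanProcess
import Summits.ResolutionOfSingularities.ResolutionOfSingularities.Theorems.WeightedInvariantLocalWeightedDropWildMonicShiftOrderCases
import Summits.ResolutionOfSingularities.ResolutionOfSingularities.Theorems.WeightedInvariantLocalWeightedDropWildMonicShiftCoeff
import Summits.ResolutionOfSingularities.ResolutionOfSingularities.Theorems.WeightedInvariantLocalWeightedDropWildMonicFlagN0Transport
import Summits.ResolutionOfSingularities.ResolutionOfSingularities.Theorems.WeightedInvariantLocalWeightedDropWildMonicFlagN1Transport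
import Summits.ResolutionOfSingularities.ResolutionOfSingularities.Theorems.WeightedInvariantLocalWeightedDropWildMonicFlagNnDefs
import Summits.ResolutionOfSingularities.ResolutionOfSingularities.Theorems.WeightedInvariantLocalWeightedDropWildPurePowerFlagStatements
import Summits.ResolutionOfSingularities.ResolutionOfSingularities.Theorems.WeightedInvariantLocalWeightedDropWildPurePowerFlagAttain

/-!
# `WeightedInvariant.LocalWeightedDrop`, line `hasse-ridge-face-selection`, S3ρ sub-stub S3ρD: item D-0 «a maximising flag exists» —
# the flag numbers are UNIFORMLY BOUNDED at a non-exit position (hbounds (ii) in full), and VALID FLAGS EXIST in every class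

Crux item stmt-ResolutionOfSingularities-8899 `LocalWeightedDrop` (route `ResolutionOfSingularities/WeightedInvariant`), engine of the
door `HypersurfaceCentreConstruction` stmt-ResolutionOfSingularities-19897.  [OURS · L1 W4.3, chain w43, res-L1-w43-stub-1 (gen 4) =
second hand on roadmap item D-0 of `L/res-L1-w43-stub-7/S3RHOD-ROADMAP.md` under the S3ρ owners res-type-083 / stub-7 and the D-0
holder res-L1-w43-stub-3 (plan-1 RULINGS gen 9 #3 (R2), CHAIN v4.10); spec `L/res-L1-w43-stub-3/D0-SPEC.md` §3–§4, consumer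
`WildMonic.attainShape_of_bounds_of_attain` (`…WildMonicFlagAttainShape`, p511775).  MODEL: S. Perlega, thesis Wien 2017 /
arXiv:2011.14443 §7.4.1 Lemma 7.4.1 «for all flags 𝓕 ∈ 𝔽 the invariants m_𝓕 and d_𝓕 are finite» and §7.2.3 (valid = `m`-maximal
flags exist); the proof here is NOT Perlega's route through Prop. 7.4.8 (kangaroo): for the EXISTENCE of a maximising flag any bound on
`d` suffices, and one is read off the `ord`-clean re-centring of Prop. 5.1.5.  Nothing here is a statement of H. Hironaka's manuscript;
every object is OURS.]

THE BOUND.  At a position `A` (`IsPos`: `ord A_j > d − j`, equivalently `d! < m_{(1,1)}(A)` on the `d!`-scale — `isPos_iff_lt_wMin`)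
that no free move puts in an exit (`¬ Exit₃ p d A`), over a perfect field of characteristic `p`: stub-7's cleaning process
(`exists_shift_isWClean_or_eq_zero`, Per17 Prop. 5.1.5) re-centres `A` to an `ord`-CLEAN tuple `C` (the zero alternative is the
fourth exit, excluded), and res-type-083's «cleanness = maximality» (`wMin_shift_le_of_isWClean`, Per17 Prop. 5.1.3) bounds the
scaled order `m_{(1,1)}` of EVERY re-centring of `C` by `M := m_{(1,1)}(C)`.  Every flag tuple `flagTuple d (orientT o A) g h` of
stub-3's family is `θ^*` of a re-centring of `C` for the legal plane change `θ = shift h` / `shiftSwap h` (formal inverse function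
theorem `FormalCoordChange.exists_comp_inverse` + stub-3's `subst_shift`), and legal plane changes preserve orders
(`WeightedShear.order_subst_of_isUnit_det`); so `δ(newtonSet (flagTuple …)) ≤ M` for ALL `(o, g, h)` — `exists_deltaL_flagTuple_le`.
CONSEQUENCES (here).  `d_𝓕 ≤ δ` (`dRes ≤ δ`; `dFlagN ≤ initHeight ≤ δ` for `n ≥ 1`: `flagTriple_fst_le_deltaL`) and
`m_𝓕 ≤ δ + n(δ + d!)` (`mOf_le`), for every admissible flag; `flagTuple_ne_zero`.  The sibling `…WildMonicFlagBoundAttain` turns these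
into hbounds (ii) of `attainShape_of_bounds_of_attain` for `Φ := IsFlagTriple d` (`exists_forall_isFlagTriple_fst_le`, no kangaroo),
the EXISTENCE OF VALID FLAGS in every class (`exists_isMMax`, Per17 §7.2.3) and D-0 from the three remaining pieces.  AI-written;
gate-accepted means sorry-free with standard axioms, not refereed.
-/

set_option linter.dupNamespace false -- mandated namespace of this single-conjunct summit

noncomputable section

namespace Summit.ResolutionOfSingularities.ResolutionOfSingularities.Theorems

namespace WildMonic

open MvPowerSeries MonicDescent
open Literature.AlgebraicGeometry.Resolution
open Literature.AlgebraicGeometry.Resolution.HauserPerlega2024 (Triple)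
open PurePowerFlag (swap swapE orient orientE IsN0 IsTangent)

variable {k : Type} [Field k] {d : ℕ}

/-! ### Positions and the `(1,1)`-scaled order `m_{(1,1)}` -/

/-- The scaled slot order for the weight `(1,1)` is `(d!/(d−j)) · ord A_j`. -/
theorem slotWOrd_one (A : Fin d → MvPowerSeries (Fin 2) k) (j : Fin d) :
    slotWOrd (fun _ => 1) A j = (slotWeight d j : ℕ∞) * (A j).order := rfl

/-- A tuple is a position iff every scaled slot order exceeds `d!`. -/
theorem isPos_iff_forall_lt_slotWOrd (A : Fin d → MvPowerSeries (Fin 2) k) :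
    IsPos d A ↔ ∀ j : Fin d, ((d.factorial : ℕ) : ℕ∞) < slotWOrd (fun _ => 1) A j := by
  refine forall_congr' fun j => ?_
  rw [slotWOrd_one, ← slotWeight_mul_sub j, Nat.cast_mul]
  constructor
  · intro hlt
    exact natCast_mul_lt_natCast_mul (slotWeight_pos j).ne' hlt
  · intro hlt
    exact lt_of_slotWeight_mul_lt j hlt

/-- **Positions are the tuples with `d! < m_{(1,1)}`** (on the `d!`-scale). -/
theorem isPos_iff_lt_wMin (A : Fin d → MvPowerSeries (Fin 2) k) :
    IsPos d A ↔ ((d.factorial : ℕ) : ℕ∞) < wMin (fun _ => 1) A := by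
  rw [isPos_iff_forall_lt_slotWOrd]
  constructor
  · intro h
    rcases Nat.eq_zero_or_pos d with hd | hd
    · subst hd
      have htop : wMin (fun _ => (1 : ℕ)) A = ⊤ := by
        unfold wMin
        exact iInf_of_empty _
      rw [htop]
      exact ENat.coe_lt_top _
    · obtain ⟨i, hi⟩ := exists_slotWOrd_eq_wMin (fun _ => 1) A hd
      rw [← hi]
      exact h i
  · intro h j
    exact lt_of_lt_of_le h (wMin_le_slotWOrd _ A j)

/-- A position has no constant terms. -/
theorem constantCoeff_eq_zero_of_isPos {A : Fin d → MvPowerSeries (Fin 2) k} (hA : IsPos d A) (j : Fin d) :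
    constantCoeff (A j) = 0 := by
  have h := hA j
  rw [← coeff_zero_eq_constantCoeff]
  apply coeff_eq_zero_of_lt_weightedOrder (fun _ => 1)
  rw [map_zero]
  calc ((0 : ℕ) : ℕ∞) < ((d - (j : ℕ) : ℕ) : ℕ∞) := by exact_mod_cast (by omega : 0 < d - (j : ℕ))
    _ < _ := h

/-- The zero tuple is a position. -/
theorem isPos_zero : IsPos d (0 : Fin d → MvPowerSeries (Fin 2) k) := fun j => by
  simp only [Pi.zero_apply, order_zero]
  exact ENat.coe_lt_top _

/-- A re-centring to the ZERO tuple is a free move into the fourth exit. -/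
theorem exit₃_of_shift_eq_zero (p : ℕ) {A : Fin d → MvPowerSeries (Fin 2) k} {g : MvPowerSeries (Fin 2) k}
    (hg0 : constantCoeff g = 0) (h0 : shift d A g = 0) : Exit₃ p d A := by
  have hXA : (fun j => subst (X : Fin 2 → MvPowerSeries (Fin 2) k) (A j)) = A := funext fun j => congrFun subst_self (A j)
  refine ⟨X, g, fun i => constantCoeff_X i, by rw [PurePowerFlag.linMat_X_det]; exact isUnit_one, hg0, ?_, Or.inr ?_⟩
  · rw [hXA, h0]; exact isPos_zero
  · rw [hXA, h0]; intro j; rfl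

/-! ### `δ` of the scaled Newton set and the scaled order -/

/-- The `(1,1)`-weight of an exponent is its degree `e₀ + e₁`. -/
theorem weight_one_eq (e : Fin 2 →₀ ℕ) : Finsupp.weight (fun _ => (1 : ℕ)) e = e 0 + e 1 := by
  rw [weight_fin_two]; ring

/-- `δ(N(A)) ≤ M` whenever `m_{(1,1)}(A) ≤ M` (in particular `A ≠ 0`). -/
theorem deltaL_newtonSet_le_of_wMin_le {A : Fin d → MvPowerSeries (Fin 2) k} {M : ℕ} (h : wMin (fun _ => 1) A ≤ (M : ℕ∞)) :
    deltaL (newtonSet A) ≤ M := by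
  have hd : 0 < d := by
    rcases Nat.eq_zero_or_pos d with h0 | h0
    · exfalso
      subst h0
      have htop : wMin (fun _ => (1 : ℕ)) A = ⊤ := by
        unfold wMin
        exact iInf_of_empty _
      rw [htop] at h
      exact absurd h (not_le.mpr (ENat.coe_lt_top M))
    · exact h0
  obtain ⟨i, hi⟩ := exists_slotWOrd_eq_wMin (fun _ => 1) A hd
  rw [← hi] at h
  have hne : A i ≠ 0 := by
    intro h0
    rw [slotWOrd_one, h0, order_zero, ENat.mul_top (by exact_mod_cast (slotWeight_pos i).ne')] at h
    exact absurd h (not_le.mpr (ENat.coe_lt_top M))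
  obtain ⟨e, he, hwe⟩ := exists_coeff_ne_zero_and_weightedOrder (fun _ => (1 : ℕ)) (f := A i)
    (ENat.coe_toNat (by rw [Ne, weightedOrder_eq_top_iff]; exact hne))
  refine le_trans (deltaL_le (smul_mem_newtonSet A i he)) ?_
  simp only [Finsupp.smul_apply, smul_eq_mul]
  have hcast : ((slotWeight d i * (e 0 + e 1) : ℕ) : ℕ∞) ≤ M := by
    rw [← weight_one_eq e, Nat.cast_mul, hwe]
    exact h
  have hnat : slotWeight d i * (e 0 + e 1) ≤ M := by exact_mod_cast hcast
  linarith [mul_add (slotWeight d i) (e 0) (e 1)]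

/-- Conversely `m_{(1,1)}(A) ≤ δ(N(A))` for a nonzero tuple. -/
theorem wMin_le_deltaL_newtonSet {A : Fin d → MvPowerSeries (Fin 2) k} (hA : (newtonSet A).Nonempty) :
    wMin (fun _ => 1) A ≤ (deltaL (newtonSet A) : ℕ∞) := by
  obtain ⟨P, hP, hPd⟩ := exists_eq_deltaL hA
  obtain ⟨j, e, he, rfl⟩ := hP
  rw [← hPd]
  simp only [Finsupp.smul_apply, smul_eq_mul]
  calc wMin (fun _ => 1) A ≤ slotWOrd (fun _ => 1) A j := wMin_le_slotWOrd _ A j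
    _ ≤ (slotWeight d j : ℕ∞) * ((Finsupp.weight (fun _ => (1 : ℕ)) e : ℕ) : ℕ∞) := by
        rw [slotWOrd_one]
        gcongr
        exact weightedOrder_le _ he
    _ = ((slotWeight d j * e 0 + slotWeight d j * e 1 : ℕ) : ℕ∞) := by
        rw [weight_one_eq]; push_cast; ring

/-- For a NONZERO tuple the two readings agree: `m_{(1,1)}(A) = δ(N(A))`. -/
theorem wMin_eq_deltaL_newtonSet {A : Fin d → MvPowerSeries (Fin 2) k} (hA : (newtonSet A).Nonempty) :
    wMin (fun _ => 1) A = (deltaL (newtonSet A) : ℕ∞) :=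
  le_antisymm (wMin_le_deltaL_newtonSet hA) (by
    have h := wMin_le_deltaL_newtonSet hA
    obtain ⟨M, hM⟩ := ENat.ne_top_iff_exists.mp (ne_top_of_le_ne_top (ENat.coe_ne_top _) h)
    rw [← hM]
    exact_mod_cast deltaL_newtonSet_le_of_wMin_le (le_of_eq hM.symm))

/-- The Newton set of a nonzero TUPLE is nonempty. -/
theorem newtonSet_nonempty {A : Fin d → MvPowerSeries (Fin 2) k} (hA : A ≠ 0) : (newtonSet A).Nonempty := by
  obtain ⟨j, hj⟩ : ∃ j, A j ≠ 0 := by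
    by_contra h
    push Not at h
    exact hA (funext h)
  exact newtonSet_nonempty_of_ne_zero hj

/-- The Newton set of the zero tuple is empty. -/
theorem newtonSet_zero : newtonSet (0 : Fin d → MvPowerSeries (Fin 2) k) = ∅ := by
  ext P
  simp only [mem_newtonSet_iff, Pi.zero_apply, coeff_zero, ne_eq, not_true_eq_false, false_and, exists_false,
    Set.mem_empty_iff_false]

/-! ### Point-set inequalities: the flag numbers are at most `δ` -/

/-- `d_F ≤ δ` for the coordinate (`n = 0`) flag. -/
theorem dRes_le_deltaL (E : Finset (Fin 2)) (N : Set (Fin 2 →₀ ℕ)) : dRes E N ≤ deltaL N := by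
  rcases N.eq_empty_or_nonempty with h | h
  · subst h
    unfold dRes reduce
    rw [Set.image_empty]
  · have := dRes_add_excExp E h
    omega

/-- `m_{F,x} ≤ n · δ` for `n ≥ 1`. -/
theorem wOrdN_le_mul_deltaL {n : ℕ} (hn : 1 ≤ n) (N : Set (Fin 2 →₀ ℕ)) : wOrdN n N ≤ n * deltaL N := by
  rcases N.eq_empty_or_nonempty with h | h
  · subst h; simp [wOrdN]
  · obtain ⟨Q, hQ, hQd⟩ := exists_eq_deltaL h
    calc wOrdN n N ≤ Q 0 + n * Q 1 := wOrdN_le n hQ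
      _ ≤ n * Q 0 + n * Q 1 := by nlinarith
      _ = n * deltaL N := by rw [← hQd]; ring

/-- `d_{F,x} ≤ δ` for `n ≥ 1`. -/
theorem initHeight_le_deltaL {n : ℕ} (hn : 1 ≤ n) (N : Set (Fin 2 →₀ ℕ)) : initHeight n N ≤ deltaL N := by
  rcases N.eq_empty_or_nonempty with h | h
  · subst h; simp [initHeight]
  · obtain ⟨P, hP, hPw, hPh⟩ := exists_eq_initHeight n h
    have h1 := wOrdN_le_mul_deltaL hn N
    rw [← hPh]
    have h2 : n * P 1 ≤ n * deltaL N := by omega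
    exact Nat.le_of_mul_le_mul_left h2 (by omega)

/-- The exceptional exponents vanish on the empty set. -/
theorem excExp_empty (E : Finset (Fin 2)) (i : Fin 2) : excExp E (∅ : Set (Fin 2 →₀ ℕ)) i = 0 := by
  fin_cases i
  · simp [alphaL]
  · simp [epsL]

/-- **`d_𝓕 ≤ δ`** of the flag tuple, for every admissible flag (either case). -/
theorem flagTriple_fst_le_deltaL {A : Fin d → MvPowerSeries (Fin 2) k} {E : Finset (Fin 2)} {g : MvPowerSeries (Fin 2) k}
    {h : PowerSeries k} (hh : PowerSeries.constantCoeff h = 0) (hadm : IsN0 E h ∨ IsTangent E h) :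
    (ofLex (flagTriple d A E g h)).1 ≤ deltaL (newtonSet (flagTuple d A g h)) := by
  by_cases hN : IsN0 E h
  · rw [flagTriple_of_isN0 hN]
    exact dRes_le_deltaL _ _
  · have hT : IsTangent E h := hadm.resolve_left hN
    rw [flagTriple_of_not_isN0 hN]
    have hn : 1 ≤ PurePowerFlag.tangency h := PurePowerFlag.one_le_tangency hh hT.2.1
    exact (dFlagN_le_initHeight _ _ _).trans (initHeight_le_deltaL hn _)

/-- **`m_𝓕 ≤ δ + n·(δ + d!)`** of the flag tuple (`n = tangency h`; both cases). -/
theorem mOf_le (A : Fin d → MvPowerSeries (Fin 2) k) (E : Finset (Fin 2)) (g : MvPowerSeries (Fin 2) k) {h : PowerSeries k}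
    (hh : PowerSeries.constantCoeff h = 0) :
    mOf d A E g h ≤ deltaL (newtonSet (flagTuple d A g h)) +
      PurePowerFlag.tangency h * (deltaL (newtonSet (flagTuple d A g h)) + d.factorial) := by
  set N := newtonSet (flagTuple d A g h) with hNdef
  by_cases hN0 : IsN0 E h
  · rw [mOf_of_isN0 hN0, ← hNdef]
    rcases N.eq_empty_or_nonempty with h0 | h0
    · rw [h0, excExp_empty, excExp_empty]; exact Nat.zero_le _
    · have := dRes_add_excExp E h0
      omega
  · have hne : h ≠ 0 := fun h0 => hN0 (Or.inr h0)
    have hn : 1 ≤ PurePowerFlag.tangency h := PurePowerFlag.one_le_tangency hh hne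
    rw [mOf_of_not_isN0 hN0, ← hNdef]
    have hw := wOrdN_le_mul_deltaL hn N
    unfold mFlagN
    split_ifs with hle
    · nlinarith
    · nlinarith

/-! ### The uniform bound -/

/-- Every flag tuple of either orientation is a re-centring of the tuple in LEGAL plane coordinates (`shift h` / `shiftSwap h`). -/
theorem exists_flagTuple_orientT_eq (o : Bool) (A : Fin d → MvPowerSeries (Fin 2) k) (g : MvPowerSeries (Fin 2) k)
    {h : PowerSeries k} (hh : PowerSeries.constantCoeff h = 0) :
    ∃ θ : Fin 2 → MvPowerSeries (Fin 2) k, (∀ i, constantCoeff (θ i) = 0) ∧ IsUnit (FormalCoordChange.linMat θ).det ∧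
      flagTuple d (orientT o A) g h = shift d (fun j => subst θ (A j)) g := by
  cases o
  · refine ⟨PurePowerFlag.shift h, PurePowerFlag.constantCoeff_shift h hh, by rw [PurePowerFlag.linMat_shift_det]; exact isUnit_one,
      ?_⟩
    rw [flagTuple_def, orientT_false]
  · refine ⟨PurePowerFlag.shiftSwap h, PurePowerFlag.constantCoeff_shiftSwap h hh,
      by rw [PurePowerFlag.linMat_shiftSwap_det]; exact isUnit_one.neg, ?_⟩
    rw [flagTuple_def, orientT_true]
    congr 1
    funext j
    rw [swapT_apply, PurePowerFlag.subst_shift_swap h hh]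

/-- Legal plane changes preserve the `(1,1)`-scaled order of a tuple. -/
theorem wMin_one_subst_eq {θ : Fin 2 → MvPowerSeries (Fin 2) k} (hθ0 : ∀ i, constantCoeff (θ i) = 0)
    (hθdet : IsUnit (FormalCoordChange.linMat θ).det) (B : Fin d → MvPowerSeries (Fin 2) k) :
    wMin (fun _ => 1) (fun j => subst θ (B j)) = wMin (fun _ => 1) B := by
  unfold wMin
  refine iInf_congr fun j => ?_
  rw [slotWOrd_one, slotWOrd_one, WeightedShear.order_subst_of_isUnit_det hθ0 hθdet]

section Bound

variable (p : ℕ) [Fact p.Prime] [CharP k p] [PerfectRing k p]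

/-- **THE UNIFORM BOUND** (Per17 Lemma 7.4.1 in game form, uniform version): at a position that no free move puts in an exit, the
`(1,1)`-scaled order `m_{(1,1)}` of EVERY re-centring in EVERY legal plane coordinate system is bounded by the scaled order `M` of the
`ord`-clean re-centring. [cite: Perlega2020, Lemma 7.4.1 with Props. 5.1.3, 5.1.5 (arXiv:2011.14443 chunks p0092, p0057–p0059)] -/
theorem exists_wMin_shift_subst_le (hd : 0 < d) {A : Fin d → MvPowerSeries (Fin 2) k} (hA : IsPos d A) (hex : ¬ Exit₃ p d A) :
    ∃ M : ℕ, ∀ (θ : Fin 2 → MvPowerSeries (Fin 2) k) (g : MvPowerSeries (Fin 2) k),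
      (∀ i, constantCoeff (θ i) = 0) → IsUnit (FormalCoordChange.linMat θ).det → constantCoeff g = 0 →
      wMin (fun _ => 1) (shift d (fun j => subst θ (A j)) g) ≤ M := by
  have hA0 : ∀ j, constantCoeff (A j) = 0 := constantCoeff_eq_zero_of_isPos hA
  obtain ⟨g₀, hg₀0, -, hcl⟩ := exists_shift_isWClean_or_eq_zero p (fun _ => 1) hd A hA0
  rcases hcl with hclean | hzero
  swap
  · exact absurd (exit₃_of_shift_eq_zero p hg₀0 hzero) hex
  set C := shift d A g₀ with hCdef
  have hCtop : wMin (fun _ => 1) C ≠ ⊤ := fun htop =>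
    hex (exit₃_of_shift_eq_zero p hg₀0 (eq_zero_of_wMin_eq_top (fun _ => 1) C htop))
  refine ⟨(wMin (fun _ => 1) C).toNat, fun θ g hθ0 hθdet hg0 => ?_⟩
  rw [ENat.coe_toNat hCtop]
  have hθs : HasSubst θ := hasSubst_of_constantCoeff_zero hθ0
  obtain ⟨ψ, hψ0, -, hθψ⟩ := FormalCoordChange.exists_comp_inverse hθ0 hθdet
  have hψs : HasSubst ψ := hasSubst_of_constantCoeff_zero hψ0
  have hback : ∀ F : MvPowerSeries (Fin 2) k, subst θ (subst ψ F) = F := fun F => by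
    rw [subst_comp_subst_apply hψs hθs, show (fun s => subst θ (ψ s)) = X from funext hθψ]
    exact congrFun subst_self F
  -- pull the re-centring back to `C`
  set g₁ := subst ψ (g - subst θ g₀) with hg₁def
  have hAC : A = shift d C (-g₀) := by rw [hCdef, shift_shift, neg_add_cancel, shift_zero]
  have hneg : subst θ (-g₀) = -subst θ g₀ := by rw [← coe_substAlgHom hθs, map_neg]
  have hθA : (fun j => subst θ (A j)) = shift d (fun i => subst θ (C i)) (subst θ (-g₀)) := by
    funext j
    rw [hAC, subst_shift hθs]
  have hLHS : shift d (fun j => subst θ (A j)) g = shift d (fun i => subst θ (C i)) (g - subst θ g₀) := by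
    rw [hθA, shift_shift, hneg, ← sub_eq_add_neg]
  have hRHS : (fun j => subst θ (shift d C g₁ j)) = shift d (fun i => subst θ (C i)) (g - subst θ g₀) := by
    funext j
    rw [subst_shift hθs, hg₁def, hback]
  rw [hLHS, ← hRHS, wMin_one_subst_eq hθ0 hθdet]
  exact wMin_shift_le_of_isWClean (fun _ => 1) C g₁ p hclean hCtop

/-- **`δ` OF EVERY FLAG TUPLE IS BOUNDED**: one `M` with `δ(newtonSet (flagTuple d (orientT o A) g h)) ≤ M` for all orientations `o`,
re-centrings `g(0) = 0` and shears `h(0) = 0`. [cite: Perlega2020, Lemma 7.4.1 (arXiv:2011.14443 chunk p0092)] -/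
theorem exists_deltaL_flagTuple_le (hd : 0 < d) {A : Fin d → MvPowerSeries (Fin 2) k} (hA : IsPos d A) (hex : ¬ Exit₃ p d A) :
    ∃ M : ℕ, ∀ (o : Bool) (g : MvPowerSeries (Fin 2) k) (h : PowerSeries k), constantCoeff g = 0 →
      PowerSeries.constantCoeff h = 0 → deltaL (newtonSet (flagTuple d (orientT o A) g h)) ≤ M := by
  obtain ⟨M, hM⟩ := exists_wMin_shift_subst_le p hd hA hex
  refine ⟨M, fun o g h hg hh => ?_⟩
  obtain ⟨θ, hθ0, hθdet, heq⟩ := exists_flagTuple_orientT_eq o A g hh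
  rw [heq]
  exact deltaL_newtonSet_le_of_wMin_le (hM θ g hθ0 hθdet hg)

omit [Fact p.Prime] [CharP k p] [PerfectRing k p] in
/-- No flag tuple of a non-exit position is the zero tuple. -/
theorem flagTuple_ne_zero {A : Fin d → MvPowerSeries (Fin 2) k} (hex : ¬ Exit₃ p d A) (o : Bool)
    {g : MvPowerSeries (Fin 2) k} (hg : constantCoeff g = 0) {h : PowerSeries k} (hh : PowerSeries.constantCoeff h = 0) :
    flagTuple d (orientT o A) g h ≠ 0 := by
  intro h0
  obtain ⟨θ, hθ0, hθdet, heq⟩ := exists_flagTuple_orientT_eq o A g hh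
  rw [heq] at h0
  have hθs : HasSubst θ := hasSubst_of_constantCoeff_zero hθ0
  refine hex ⟨θ, g, hθ0, hθdet, hg, ?_, Or.inr ?_⟩
  · rw [h0]; exact isPos_zero
  · rw [h0]; intro j; rfl

end Bound

end WildMonic

end Summit.ResolutionOfSingularities.ResolutionOfSingularities.Theorems

end
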